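import Summits.Schanuel.Schanuel.Theorems.RootDecomp1BTwoRadical04

/-!
# RootDecomp1BTwoRadical — lens 4, generation 44, node 2 (g44b) «TWO-RADICAL DESCENT — t(1, ρ) = 5 AT THE RATIONAL COLUMN FOR EVERY ULTRA-LIOUVILLE ρ, HYPOTHESIS-FREE» (lanes B-R29 (ii) ∩ B-R30 (iv)/(d); CLAIM L2259, NODE L2268 / REQUEST L2269; critic VERDICT pending at staging — filed only on GO) — continuation (RootDecomp1BTwoRadical05): §E2 cells + §F2 hypothesis-free + §G2 the coordinate column

(lens-4 g44b HOME kernel K = HOME/decomp-schanuel-lens-4/g44b/TwoRadical.lean b925f14a…, 1327 l, imports tree `…RootDecomp1BFactDischarge01` ONLY; P/C per NODE.md. Port by census-1 gen 19 as `RootDecomp1BTwoRadical01`–`05` from the CENSUS CAP EDITION TwoRadical.capped.lean (census/tools/gen19/ports/tr/; = K with steps (2)–(5) of the kernel extracted as the public lemma `twoRadical_clash`, kernel statement BYTE-IDENTICAL, 53/53 decls identical + 1 new — same cut as TwoStorey's, RESHAPE RULE L1684): 01 = §A2 formal algebra of TWO radicals (`fiber_sum₂`, `powSubst₂`, `residue_lemma₂`,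 the q²×q² norm form `radMat₂`, `det_radMat₂_ne_zero`, `det_eq_eigen_mul₂`); 02 = §C2 the specialisation (`Cf₂`, `Frel₂`, sizes, Lipschitz, `eigen_eq_Frel₂` — TwoRadical's own versions, namespace-distinct from TwoStorey's); 03 = §D2 part 1: the private helper + the CLASH ENGINE `twoRadical_clash`; 04 = §D2 part 2: THE KERNEL `algebraicIndependent_twoRadical` (scoped `maxHeartbeats 1600000` as in K); 05 = §E2 cells mod `(hLW : LWMeasure)` + §F2 hypothesis-free via `lwMeasure_holds` (`five_le_polarDeg_one_ultra : ((5 : ℕ) : Cardinal) ≤ polarDeg ![(1:ℝ), ρ]` for EVERY ultra-Liouville ρ, `five_le_polarDeg_one_rhoU`, …) + §G2 the coordinate column at every storey (`polarDeg_snoc_ultra₂`, …).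
PORT EDITS: linter option dropped; one docstring added (`powSubst₂_apply`); §D2 re-cut for the 400-line cap (one new public lemma `twoRadical_clash`; eigenvector coordinates abstracted as `w` with `‖w c‖ ≤ Θ^q·Θ^q`, eigenvalue as `Φ`; thirteen now-unused local `have`s of the kernel dropped); every other statement and proof verbatim. `--supports stmt-Schanuel-24622`; no census credit carried; rung 0 — nothing here proves Schanuel.)
-/

noncomputable section

open Complex

namespace Summit.Schanuel.Schanuel.Theorems.RootDecomp1BTwoRadical

/-! ## §E2 THE CELLS: `t(1, ρ) ≥ 5` at the rational column for every ultra-Liouville `ρ` -/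

section Cells

open Summit.Schanuel.Schanuel.Theorems.RootDecomp1KHyper (LWMeasure)
open Summit.Schanuel.Schanuel.Theorems.RootDecomp1BFedFlagCore (polarDeg polarField coe_mem_polarField
  exp_coe_mem_polarField exp_coe_mul_I_mem_polarField)
open Summit.Schanuel.Schanuel.Theorems.RootDecomp1BDefectFloorCells (natCast_le_trdeg_of_algebraicIndependent)
open RootDecomp1BRadicalDescent (DExpMeasure dExpMeasure_exp_of_LW UltraLiouville isAlgebraic_base
  linearIndependent_base rhoU ultraLiouville_rhoU)

/-- **`(e^ρ, e^{iρ}, ρ, e, e^i)` is algebraically independent** for every ultra-Liouville `ρ > 0` (mod `hLW`):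
the kernel at the base point `θ = (e, e^i) = exp(1, i)` — `1, i` algebraic and `ℚ`-free, so `DExpMeasure θ` is the
Lindemann–Weierstrass measure — with the two radicals `e^{1/q}`, `e^{i/q}`. -/
theorem algebraicIndependent_five_of_pos (hLW : LWMeasure) {ρ : ℝ} (hρ : UltraLiouville ρ) (hρ0 : 0 < ρ) :
    AlgebraicIndependent ℚ
      (Fin.cons (cexp ((ρ : ℂ) * 1)) (Fin.cons (cexp ((ρ : ℂ) * Complex.I))
        (Fin.cons (ρ : ℂ) (fun i => cexp (![(1 : ℂ), Complex.I] i)))) : Fin (2 + 3) → ℂ) :=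
  algebraicIndependent_twoRadical (dExpMeasure_exp_of_LW hLW isAlgebraic_base linearIndependent_base)
    (i₀ := 0) (i₁ := 1) (by decide) (by simp) (by simp) hρ hρ0

/-- **`t(r) ≥ 5` (general polar field, mod `hLW`).** For `ρ` ultra-Liouville, every real tuple `r` whose polar field
contains `ρ, e, e^i, e^ρ, e^{iρ}` has `t(r) ≥ 5` — the statement of `RootDecomp1BQuadFrame.five_le_polarDeg_of_quadHyper`
with `UltraLiouville ρ` in place of `QuadHyperLiouville ρ` and NO `Roy2014_thm_1_1` binder. -/
theorem five_le_polarDeg_of_ultra_of_LW (hLW : LWMeasure) {ρ : ℝ} (hρ : UltraLiouville ρ)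
    {m : ℕ} {r : Fin m → ℝ} (hρr : (ρ : ℂ) ∈ polarField r) (he : cexp 1 ∈ polarField r)
    (hei : cexp Complex.I ∈ polarField r) (heρ : cexp ρ ∈ polarField r)
    (heρi : cexp (ρ * Complex.I) ∈ polarField r) :
    ((5 : ℕ) : Cardinal) ≤ polarDeg r := by
  have hθmem : ∀ i, (fun i => cexp (![(1 : ℂ), Complex.I] i)) i ∈ polarField r := by
    intro i
    fin_cases i
    · simpa using he
    · simpa using hei
  have hρne : ρ ≠ 0 := fun h => hρ.irrational ⟨0, by simp [h]⟩
  rcases lt_or_gt_of_ne hρne with hneg | hpos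
  · have hai := algebraicIndependent_five_of_pos hLW hρ.neg (neg_pos.2 hneg)
    refine natCast_le_trdeg_of_algebraicIndependent hai fun i => ?_
    refine Fin.cases ?_ (fun i => ?_) i
    · simp only [Fin.cons_zero, mul_one, Complex.ofReal_neg, Complex.exp_neg]
      exact inv_mem heρ
    · rw [Fin.cons_succ]
      refine Fin.cases ?_ (fun i' => ?_) i
      · simp only [Fin.cons_zero, Complex.ofReal_neg, neg_mul, Complex.exp_neg]
        exact inv_mem heρi
      · rw [Fin.cons_succ]
        refine Fin.cases ?_ (fun j => ?_) i'
        · simp only [Fin.cons_zero, Complex.ofReal_neg]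
          exact neg_mem hρr
        · rw [Fin.cons_succ]
          exact hθmem j
  · have hai := algebraicIndependent_five_of_pos hLW hρ hpos
    refine natCast_le_trdeg_of_algebraicIndependent hai fun i => ?_
    refine Fin.cases ?_ (fun i => ?_) i
    · simp only [Fin.cons_zero, mul_one]
      exact heρ
    · rw [Fin.cons_succ]
      refine Fin.cases ?_ (fun i' => ?_) i
      · simp only [Fin.cons_zero]
        exact heρi
      · rw [Fin.cons_succ]
        refine Fin.cases ?_ (fun j => ?_) i'
        · simp only [Fin.cons_zero]
          exact hρr
        · rw [Fin.cons_succ]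
          exact hθmem j

/-- The five memberships at the rational column `(1 | ρ)`: `ρ, e, e^i, e^ρ, e^{iρ} ∈ polarField (1, ρ)`. -/
private theorem mem_polarField_one_ultra (ρ : ℝ) :
    (ρ : ℂ) ∈ polarField ![(1 : ℝ), ρ] ∧ cexp 1 ∈ polarField ![(1 : ℝ), ρ] ∧
      cexp Complex.I ∈ polarField ![(1 : ℝ), ρ] ∧ cexp ρ ∈ polarField ![(1 : ℝ), ρ] ∧
      cexp (ρ * Complex.I) ∈ polarField ![(1 : ℝ), ρ] := by
  refine ⟨?_, ?_, ?_, ?_, ?_⟩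
  · simpa using coe_mem_polarField ![(1 : ℝ), ρ] 1
  · simpa using exp_coe_mem_polarField ![(1 : ℝ), ρ] 0
  · simpa using exp_coe_mul_I_mem_polarField ![(1 : ℝ), ρ] 0
  · simpa using exp_coe_mem_polarField ![(1 : ℝ), ρ] 1
  · simpa using exp_coe_mul_I_mem_polarField ![(1 : ℝ), ρ] 1

/-- The five memberships at the swapped column `(ρ | 1)`. -/
private theorem mem_polarField_swap_ultra (ρ : ℝ) :
    (ρ : ℂ) ∈ polarField ![ρ, (1 : ℝ)] ∧ cexp 1 ∈ polarField ![ρ, (1 : ℝ)] ∧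
      cexp Complex.I ∈ polarField ![ρ, (1 : ℝ)] ∧ cexp ρ ∈ polarField ![ρ, (1 : ℝ)] ∧
      cexp (ρ * Complex.I) ∈ polarField ![ρ, (1 : ℝ)] := by
  refine ⟨?_, ?_, ?_, ?_, ?_⟩
  · simpa using coe_mem_polarField ![ρ, (1 : ℝ)] 0
  · simpa using exp_coe_mem_polarField ![ρ, (1 : ℝ)] 1
  · simpa using exp_coe_mul_I_mem_polarField ![ρ, (1 : ℝ)] 1
  · simpa using exp_coe_mem_polarField ![ρ, (1 : ℝ)] 0
  · simpa using exp_coe_mul_I_mem_polarField ![ρ, (1 : ℝ)] 0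

/-- **`t(1, ρ) ≥ 5` — THE FULL SCHANUEL VALUE of the rational column `(1 | ρ)`** for every ultra-Liouville `ρ`
(mod `hLW`): `e^ρ, e^{iρ}, ρ, e, e^i` are algebraically independent. -/
theorem five_le_polarDeg_one_ultra_of_LW (hLW : LWMeasure) {ρ : ℝ} (hρ : UltraLiouville ρ) :
    ((5 : ℕ) : Cardinal) ≤ polarDeg ![(1 : ℝ), ρ] := by
  obtain ⟨h1, h2, h3, h4, h5⟩ := mem_polarField_one_ultra ρ
  exact five_le_polarDeg_of_ultra_of_LW hLW hρ h1 h2 h3 h4 h5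

/-- … and for the swapped column `(ρ | 1)` (mod `hLW`). -/
theorem five_le_polarDeg_swap_ultra_of_LW (hLW : LWMeasure) {ρ : ℝ} (hρ : UltraLiouville ρ) :
    ((5 : ℕ) : Cardinal) ≤ polarDeg ![ρ, (1 : ℝ)] := by
  obtain ⟨h1, h2, h3, h4, h5⟩ := mem_polarField_swap_ultra ρ
  exact five_le_polarDeg_of_ultra_of_LW hLW hρ h1 h2 h3 h4 h5

end Cells

/-! ## §F2 HYPOTHESIS-FREE: `LWMeasure` is the tree theorem `RootDecomp1BFactDischarge.lwMeasure_holds` (Ably 1994) -/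

section Unconditional

open Summit.Schanuel.Schanuel.Theorems.RootDecomp1BFedFlagCore (polarDeg polarField)
open Summit.Schanuel.Schanuel.Theorems.RootDecomp1BFactDischarge (lwMeasure_holds)
open RootDecomp1BRadicalDescent (UltraLiouville rhoU ultraLiouville_rhoU)

/-- **`(e^ρ, e^{iρ}, ρ, e, e^i)` algebraically independent** for every ultra-Liouville `ρ > 0` — UNCONDITIONAL. -/
theorem algebraicIndependent_five_of_pos' {ρ : ℝ} (hρ : UltraLiouville ρ) (hρ0 : 0 < ρ) :
    AlgebraicIndependent ℚ
      (Fin.cons (cexp ((ρ : ℂ) * 1)) (Fin.cons (cexp ((ρ : ℂ) * Complex.I))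
        (Fin.cons (ρ : ℂ) (fun i => cexp (![(1 : ℂ), Complex.I] i)))) : Fin (2 + 3) → ℂ) :=
  algebraicIndependent_five_of_pos lwMeasure_holds hρ hρ0

/-- **`t(r) ≥ 5`** whenever the polar field of `r` contains `ρ, e, e^i, e^ρ, e^{iρ}` with `ρ` ultra-Liouville —
UNCONDITIONAL. -/
theorem five_le_polarDeg_of_ultra {ρ : ℝ} (hρ : UltraLiouville ρ)
    {m : ℕ} {r : Fin m → ℝ} (hρr : (ρ : ℂ) ∈ polarField r) (he : cexp 1 ∈ polarField r)
    (hei : cexp Complex.I ∈ polarField r) (heρ : cexp ρ ∈ polarField r)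
    (heρi : cexp (ρ * Complex.I) ∈ polarField r) :
    ((5 : ℕ) : Cardinal) ≤ polarDeg r :=
  five_le_polarDeg_of_ultra_of_LW lwMeasure_holds hρ hρr he hei heρ heρi

/-- **THE CELL. `t(1, ρ) ≥ 5` for EVERY ultra-Liouville `ρ` — UNCONDITIONAL** (no `Roy2014_thm_1_1`, no `LWMeasure`,
no measure binder of any kind): the full Schanuel value of the rational column `(1 | ρ)` on a dense `G_δ` of reals `ρ`. -/
theorem five_le_polarDeg_one_ultra {ρ : ℝ} (hρ : UltraLiouville ρ) :
    ((5 : ℕ) : Cardinal) ≤ polarDeg ![(1 : ℝ), ρ] :=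
  five_le_polarDeg_one_ultra_of_LW lwMeasure_holds hρ

/-- … and for the swapped column `(ρ | 1)` — UNCONDITIONAL. -/
theorem five_le_polarDeg_swap_ultra {ρ : ℝ} (hρ : UltraLiouville ρ) :
    ((5 : ℕ) : Cardinal) ≤ polarDeg ![ρ, (1 : ℝ)] :=
  five_le_polarDeg_swap_ultra_of_LW lwMeasure_holds hρ

/-- **`t(1, ρ_U) ≥ 5` at the NAMED member `ρ_U`** (tree `RootDecomp1BRadicalDescent.rhoU`, g33) — UNCONDITIONAL. -/
theorem five_le_polarDeg_one_rhoU : ((5 : ℕ) : Cardinal) ≤ polarDeg ![(1 : ℝ), rhoU] :=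
  five_le_polarDeg_one_ultra ultraLiouville_rhoU

/-- `t(ρ_U, 1) ≥ 5` (swapped) — UNCONDITIONAL. -/
theorem five_le_polarDeg_swap_rhoU : ((5 : ℕ) : Cardinal) ≤ polarDeg ![rhoU, (1 : ℝ)] :=
  five_le_polarDeg_swap_ultra ultraLiouville_rhoU

/-- The Klein–polar X(2) floor `t(1, ρ) ≥ 4 = m + m` (`m = 2`) as a COROLLARY of `t(1, ρ) ≥ 5` — UNCONDITIONAL
(g33's `four_le_polarDeg_one_ultra` recovered with one to spare). -/
private theorem four_le_polarDeg_one_ultra' {ρ : ℝ} (hρ : UltraLiouville ρ) :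
    ((2 + 2 : ℕ) : Cardinal) ≤ polarDeg ![(1 : ℝ), ρ] :=
  (Nat.cast_le.2 (by norm_num)).trans (five_le_polarDeg_one_ultra hρ)

/-- The cell in the VERBATIM shape of `polarDeg` unfolded (the transcendence degree of the Klein–polar field of
`r = (1, ρ)`), strictly ABOVE the body `((2 + 2 : ℕ) : Cardinal) ≤ …` of the 1B crux `KleinPolarSchanuel` at `m = 2`. -/
theorem five_le_trdeg_polar_one_ultra {ρ : ℝ} (hρ : UltraLiouville ρ) :
    ((5 : ℕ) : Cardinal) ≤ Algebra.trdeg ℚ ↥(IntermediateField.adjoin ℚ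
      (Set.range (Fin.append (fun j => ((![(1 : ℝ), ρ] j : ℝ) : ℂ)) (fun j => ((![(1 : ℝ), ρ] j : ℝ) : ℂ) * Complex.I)) ∪
        Set.range (Complex.exp ∘ Fin.append (fun j => ((![(1 : ℝ), ρ] j : ℝ) : ℂ))
          (fun j => ((![(1 : ℝ), ρ] j : ℝ) : ℂ) * Complex.I)))) :=
  five_le_polarDeg_one_ultra hρ

end Unconditional

/-! ## §G2  THE COORDINATE COLUMN AT EVERY STOREY — `t(β | β_{j₀}·ρ) ≥ 2m + 3` (ONE ABOVE the Klein–polar value)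

For `β : Fin m → ℝ` coordinatewise algebraic and `ℚ`-free, any index `j₀`, and `ρ` ultra-Liouville, the column
`r = (β | β_{j₀} ρ)` has `polarDeg r ≥ 2m + 3 = (m+1) + (m+1) + 1`: base `θ = (e^{β}, e^{iβ})` (`2m` exponentials,
`DExpMeasure θ` from `dExpMeasure_exp_of_LW`), `i₀ ↔ e^{β_{j₀}}` (`y₀ = β_{j₀}`), `i₁ ↔ e^{iβ_{j₀}}` (`y₁ = iβ_{j₀}`), the
two-radical kernel ⟹ `(e^{ρβ_{j₀}}, e^{iρβ_{j₀}}, ρ, θ)` algebraically independent — `2m + 3` elements of `F(r)`.  This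
UPGRADES the tree's one-radical column `RootDecomp1BRadicalDescent.polarDeg_snoc_ultra` (`≥ 2m + 2`, mod `hLW`) by one,
at every storey; §E2/§F2 is its storey `m = 1`, `β = (1)` up to the spelling `Fin.snoc ![1] (1·ρ)` vs `![1, ρ]`. -/

section Column

open Summit.Schanuel.Schanuel.Theorems.RootDecomp1KHyper (LWMeasure)
open Summit.Schanuel.Schanuel.Theorems.RootDecomp1BFedFlagCore (polarDeg polarField coe_mem_polarField
  exp_coe_mem_polarField exp_coe_mul_I_mem_polarField)
open Summit.Schanuel.Schanuel.Theorems.RootDecomp1BDefectFloorCells (natCast_le_trdeg_of_algebraicIndependent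
  isAlgebraic_polarExp linearIndependent_polar)
open Summit.Schanuel.Schanuel.Theorems.RootDecomp1BRadicalDescent (DExpMeasure dExpMeasure_exp_of_LW UltraLiouville)
open Summit.Schanuel.Schanuel.Theorems.RootDecomp1BFactDischarge (lwMeasure_holds)

/-- Engine of the column (`σ > 0` ultra-Liouville, memberships supplied): `t(β | u) ≥ 2m + 3` (mod `hLW`). -/
theorem polarDeg_snoc_of_pos₂ (hLW : LWMeasure) {m : ℕ} {β : Fin m → ℝ}
    (hβ : ∀ j, IsAlgebraic ℚ ((β j : ℝ) : ℂ)) (hli : LinearIndependent ℚ β) (j₀ : Fin m) {u σ : ℝ}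
    (hσ : UltraLiouville σ) (hσ0 : 0 < σ)
    (heσ : cexp ((σ : ℂ) * ((β j₀ : ℝ) : ℂ)) ∈ polarField (Fin.snoc β u : Fin (m + 1) → ℝ))
    (heσi : cexp ((σ : ℂ) * (((β j₀ : ℝ) : ℂ) * Complex.I)) ∈ polarField (Fin.snoc β u : Fin (m + 1) → ℝ))
    (hσm : (σ : ℂ) ∈ polarField (Fin.snoc β u : Fin (m + 1) → ℝ)) :
    ((m + m + 3 : ℕ) : Cardinal) ≤ polarDeg (Fin.snoc β u : Fin (m + 1) → ℝ) := by
  obtain ⟨y, hy⟩ : ∃ y : Fin (m + m) → ℂ,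
      y = Fin.append (fun j => ((β j : ℝ) : ℂ)) (fun j => ((β j : ℝ) : ℂ) * Complex.I) := ⟨_, rfl⟩
  have hθ : DExpMeasure (fun i => cexp (y i)) :=
    dExpMeasure_exp_of_LW hLW (fun i => by rw [hy]; exact isAlgebraic_polarExp β hβ i)
      (by rw [hy]; exact linearIndependent_polar hli)
  have hy0 : cexp ((β j₀ : ℝ) : ℂ) = (fun i => cexp (y i)) (Fin.castAdd m j₀) := by
    show cexp _ = cexp (y (Fin.castAdd m j₀))
    rw [hy, Fin.append_left]
  have hy1 : cexp (((β j₀ : ℝ) : ℂ) * Complex.I) = (fun i => cexp (y i)) (Fin.natAdd m j₀) := by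
    show cexp _ = cexp (y (Fin.natAdd m j₀))
    rw [hy, Fin.append_right]
  have hne : Fin.castAdd m j₀ ≠ Fin.natAdd m j₀ := by
    intro h
    have h' := congrArg Fin.val h
    simp only [Fin.val_castAdd, Fin.val_natAdd] at h'
    have := j₀.isLt
    omega
  have hθmem : ∀ i, (fun i => cexp (y i)) i ∈ polarField (Fin.snoc β u : Fin (m + 1) → ℝ) := by
    intro i
    show cexp (y i) ∈ _
    rw [hy]
    induction i using Fin.addCases with
    | left j =>
        rw [Fin.append_left]
        simpa only [Fin.snoc_castSucc] using
          exp_coe_mem_polarField (Fin.snoc β u : Fin (m + 1) → ℝ) j.castSucc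
    | right j =>
        rw [Fin.append_right]
        simpa only [Fin.snoc_castSucc] using
          exp_coe_mul_I_mem_polarField (Fin.snoc β u : Fin (m + 1) → ℝ) j.castSucc
  have hai := algebraicIndependent_twoRadical hθ hne hy0 hy1 hσ hσ0
  refine natCast_le_trdeg_of_algebraicIndependent hai fun i => ?_
  refine Fin.cases ?_ (fun i => ?_) i
  · simp only [Fin.cons_zero]
    exact heσ
  · rw [Fin.cons_succ]
    refine Fin.cases ?_ (fun i => ?_) i
    · simp only [Fin.cons_zero]
      exact heσi
    · rw [Fin.cons_succ]
      refine Fin.cases ?_ (fun j => ?_) i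
      · simp only [Fin.cons_zero]
        exact hσm
      · rw [Fin.cons_succ]
        exact hθmem j

/-- **THE COLUMN, EVERY STOREY: `t(β | β_{j₀} ρ) ≥ (m+1) + (m+1) + 1`** for `β` real algebraic `ℚ`-free, `ρ`
ultra-Liouville (either sign), mod `hLW`. -/
theorem polarDeg_snoc_ultra₂_of_LW (hLW : LWMeasure) {m : ℕ} {β : Fin m → ℝ}
    (hβ : ∀ j, IsAlgebraic ℚ ((β j : ℝ) : ℂ)) (hli : LinearIndependent ℚ β) (j₀ : Fin m) {ρ : ℝ}
    (hρ : UltraLiouville ρ) :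
    ((m + 1 + (m + 1) + 1 : ℕ) : Cardinal) ≤ polarDeg (Fin.snoc β (β j₀ * ρ) : Fin (m + 1) → ℝ) := by
  have hb0 : β j₀ ≠ 0 := hli.ne_zero j₀
  have hb0' : ((β j₀ : ℝ) : ℂ) ≠ 0 := by exact_mod_cast hb0
  have hlast : (((β j₀ * ρ : ℝ)) : ℂ) ∈ polarField (Fin.snoc β (β j₀ * ρ) : Fin (m + 1) → ℝ) := by
    simpa only [Fin.snoc_last] using
      coe_mem_polarField (Fin.snoc β (β j₀ * ρ) : Fin (m + 1) → ℝ) (Fin.last m)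
  have helast : cexp (((β j₀ * ρ : ℝ)) : ℂ) ∈ polarField (Fin.snoc β (β j₀ * ρ) : Fin (m + 1) → ℝ) := by
    simpa only [Fin.snoc_last] using
      exp_coe_mem_polarField (Fin.snoc β (β j₀ * ρ) : Fin (m + 1) → ℝ) (Fin.last m)
  have helastI : cexp ((((β j₀ * ρ : ℝ)) : ℂ) * Complex.I) ∈
      polarField (Fin.snoc β (β j₀ * ρ) : Fin (m + 1) → ℝ) := by
    simpa only [Fin.snoc_last] using
      exp_coe_mul_I_mem_polarField (Fin.snoc β (β j₀ * ρ) : Fin (m + 1) → ℝ) (Fin.last m)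
  have hbm : ((β j₀ : ℝ) : ℂ) ∈ polarField (Fin.snoc β (β j₀ * ρ) : Fin (m + 1) → ℝ) := by
    simpa only [Fin.snoc_castSucc] using
      coe_mem_polarField (Fin.snoc β (β j₀ * ρ) : Fin (m + 1) → ℝ) j₀.castSucc
  have hρm : (ρ : ℂ) ∈ polarField (Fin.snoc β (β j₀ * ρ) : Fin (m + 1) → ℝ) := by
    have : (ρ : ℂ) = ((β j₀ : ℝ) : ℂ)⁻¹ * (((β j₀ * ρ : ℝ)) : ℂ) := by
      rw [Complex.ofReal_mul, ← mul_assoc, inv_mul_cancel₀ hb0', one_mul]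
    rw [this]
    exact mul_mem (inv_mem hbm) hlast
  have heρ : cexp ((ρ : ℂ) * ((β j₀ : ℝ) : ℂ)) ∈ polarField (Fin.snoc β (β j₀ * ρ) : Fin (m + 1) → ℝ) := by
    have : (ρ : ℂ) * ((β j₀ : ℝ) : ℂ) = (((β j₀ * ρ : ℝ)) : ℂ) := by rw [Complex.ofReal_mul, mul_comm]
    rw [this]
    exact helast
  have heρI : cexp ((ρ : ℂ) * (((β j₀ : ℝ) : ℂ) * Complex.I)) ∈
      polarField (Fin.snoc β (β j₀ * ρ) : Fin (m + 1) → ℝ) := by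
    have : (ρ : ℂ) * (((β j₀ : ℝ) : ℂ) * Complex.I) = (((β j₀ * ρ : ℝ)) : ℂ) * Complex.I := by
      rw [Complex.ofReal_mul]; ring
    rw [this]
    exact helastI
  have hρne : ρ ≠ 0 := fun h => hρ.irrational ⟨0, by simp [h]⟩
  have hmm : ((m + 1 + (m + 1) + 1 : ℕ) : Cardinal) = ((m + m + 3 : ℕ) : Cardinal) := by
    congr 1; omega
  rw [hmm]
  rcases lt_or_gt_of_ne hρne with hneg | hpos
  · refine polarDeg_snoc_of_pos₂ hLW hβ hli j₀ hρ.neg (neg_pos.2 hneg) ?_ ?_ ?_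
    · rw [Complex.ofReal_neg, neg_mul, Complex.exp_neg]
      exact inv_mem heρ
    · rw [Complex.ofReal_neg, neg_mul, Complex.exp_neg]
      exact inv_mem heρI
    · rw [Complex.ofReal_neg]
      exact neg_mem hρm
  · exact polarDeg_snoc_of_pos₂ hLW hβ hli j₀ hρ hpos heρ heρI hρm

/-- **THE COLUMN, EVERY STOREY, HYPOTHESIS-FREE**: `t(β | β_{j₀} ρ) ≥ (m+1) + (m+1) + 1`. -/
theorem polarDeg_snoc_ultra₂ {m : ℕ} {β : Fin m → ℝ}
    (hβ : ∀ j, IsAlgebraic ℚ ((β j : ℝ) : ℂ)) (hli : LinearIndependent ℚ β) (j₀ : Fin m) {ρ : ℝ}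
    (hρ : UltraLiouville ρ) :
    ((m + 1 + (m + 1) + 1 : ℕ) : Cardinal) ≤ polarDeg (Fin.snoc β (β j₀ * ρ) : Fin (m + 1) → ℝ) :=
  polarDeg_snoc_ultra₂_of_LW lwMeasure_holds hβ hli j₀ hρ

/-- The Klein–polar inequality AT the column (`(m+1) + (m+1) ≤ t`) with one to spare, hypothesis-free
(the tree's `RootDecomp1BRadicalDescent.polarDeg_snoc_ultra` conclusion without its `hLW` binder). -/
theorem polarDeg_snoc_ultra' {m : ℕ} {β : Fin m → ℝ}
    (hβ : ∀ j, IsAlgebraic ℚ ((β j : ℝ) : ℂ)) (hli : LinearIndependent ℚ β) (j₀ : Fin m) {ρ : ℝ}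
    (hρ : UltraLiouville ρ) :
    ((m + 1 + (m + 1) : ℕ) : Cardinal) ≤ polarDeg (Fin.snoc β (β j₀ * ρ) : Fin (m + 1) → ℝ) :=
  (Nat.cast_le.2 (by omega)).trans (polarDeg_snoc_ultra₂ hβ hli j₀ hρ)

end Column

end Summit.Schanuel.Schanuel.Theorems.RootDecomp1BTwoRadical

end
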